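import Mathlib.Analysis.SpecialFunctions.Pow.Deriv
import Mathlib.Analysis.SpecialFunctions.Pow.Continuity
import Mathlib.Analysis.Calculus.ContDiff.RCLike
import Mathlib.Analysis.Calculus.MeanValue
import Literature.Probability.LatticeModels.FarFieldExpansion
import HarnessLib

/-!
# Far-field expansion of the pure power `c ‖x₀ - y‖ ^ (-2Δ)`

Topic: Probability / LatticeModels; companion of
`Literature.Probability.LatticeModels.FarFieldExpansion` (the predicate `HasFarFieldExpansion`).

The two-point function of a quasi-primary field of dimension `Δ` is `C₁₂ ‖x₁ - x₂‖^{-2Δ}`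
(Di Francesco–Mathieu–Sénéchal, *Conformal Field Theory*, Springer 1997, §4.3.1, eq. (4.55)).
Here we prove its first-order expansion at infinity,

  `c ‖x₀ - y‖^{-2Δ} = ‖y‖^{-2Δ} [ c + 2Δ c ŷ·x₀ / ‖y‖ + O(1/‖y‖²) ]`,

uniformly for `x₀` in bounded sets (`tendsto_farField_rpow`), and deduce
`HasFarFieldExpansion S Δ n (fun _ => c) (fun x => (2Δc) • x₀ x)` whenever
`S_{n+1}(x, y) = c ‖x₀(x) - y‖^{-2Δ}` with a source point `x₀(x)` depending continuously on the
configuration (`hasFarFieldExpansion_of_eq_rpow`, `…_coord`, `hasFarFieldExpansion_twoPoint`):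
monopole `c`, dipole `2Δ c x₀` — the input "monopole `c S_n(x)`, dipole `2Δ c S_n(x) z`" of the
clustering item `FarFieldClustering` of route PrimaryAtInfinity. Also: additivity and scaling of
far-field expansions (`HasFarFieldExpansion.add`, `HasFarFieldExpansion.smul`).

The analytic input is a second-order Taylor bound `|w^{-Δ} - 1 + Δ(w-1)| ≤ C (w-1)²` near
`w = 1` (`exists_rpow_neg_sub_taylor_bound`, from `ContDiffAt.exists_lipschitzOnWith` and the
mean value inequality `Convex.norm_image_sub_le_of_norm_hasDerivWithin_le`), applied with
`w = ‖x₀ - y‖² / ‖y‖² = 1 + (‖x₀‖² - 2⟪x₀, y⟫)/‖y‖²`.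
-/

namespace Literature.Probability.LatticeModels

open Filter
open scoped Topology

variable {d : ℕ} {S S' : CorrFamily d} {Δ : ℝ} {n : ℕ}
  {A₀ B₀ : (Fin n → EuclideanSpace ℝ (Fin d)) → ℝ}
  {A₁ B₁ : (Fin n → EuclideanSpace ℝ (Fin d)) → EuclideanSpace ℝ (Fin d)}

/-! ### The explicit expansion of the pure power `c ‖x₀ - y‖ ^ (-2Δ)` -/

/-- Second-order Taylor bound for `w ↦ w^(-Δ)` at `w = 1`:
`|w^(-Δ) - 1 + Δ (w - 1)| ≤ C (w - 1)²` for `w` near `1` (mean value theorem applied to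
`w ↦ w^(-Δ) - 1 + Δ (w - 1)`, whose derivative is Lipschitz near `1`). [folklore] -/
theorem exists_rpow_neg_sub_taylor_bound (Δ : ℝ) :
    ∃ C δ : ℝ, 0 ≤ C ∧ 0 < δ ∧ ∀ w : ℝ, |w - 1| < δ →
      |w ^ (-Δ) - 1 + Δ * (w - 1)| ≤ C * (w - 1) ^ 2 := by
  have hcd : ContDiffAt ℝ 1 (fun w : ℝ => -Δ * w ^ (-Δ - 1)) 1 :=
    contDiffAt_const.mul (Real.contDiffAt_rpow_const_of_ne one_ne_zero)
  obtain ⟨K, t, ht, hK⟩ := hcd.exists_lipschitzOnWith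
  obtain ⟨δ, hδ, hball⟩ := Metric.mem_nhds_iff.mp ht
  refine ⟨K, min δ (1 / 2), K.coe_nonneg, lt_min hδ one_half_pos, fun w hw => ?_⟩
  have hwδ : |w - 1| < δ := hw.trans_le (min_le_left _ _)
  have hw2 : |w - 1| < 1 / 2 := hw.trans_le (min_le_right _ _)
  have h1t : (1 : ℝ) ∈ t := mem_of_mem_nhds ht
  have hI : ∀ z ∈ Set.uIcc 1 w, 0 < z ∧ z ∈ t := fun z hz => by
    have hz1 : |z - 1| ≤ |w - 1| := Set.abs_sub_left_of_mem_uIcc hz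
    refine ⟨?_, hball ?_⟩
    · have := (abs_lt.mp (hz1.trans_lt hw2)).1
      linarith
    · rw [Metric.mem_ball, Real.dist_eq]
      exact hz1.trans_lt hwδ
  have hderiv : ∀ z ∈ Set.uIcc 1 w,
      HasDerivWithinAt (fun z : ℝ => z ^ (-Δ) - 1 + Δ * (z - 1))
        (-Δ * z ^ (-Δ - 1) - (-Δ)) (Set.uIcc 1 w) z := fun z hz => by
    have h1 : HasDerivAt (fun z : ℝ => z ^ (-Δ)) (-Δ * z ^ (-Δ - 1)) z :=
      Real.hasDerivAt_rpow_const (Or.inl (hI z hz).1.ne')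
    have h2 : HasDerivAt (fun z : ℝ => z ^ (-Δ) - 1 + Δ * (z - 1))
        (-Δ * z ^ (-Δ - 1) + Δ * 1) z :=
      (h1.sub_const 1).add (((hasDerivAt_id' z).sub_const 1).const_mul Δ)
    exact (h2.congr_deriv (by ring)).hasDerivWithinAt
  have hbound : ∀ z ∈ Set.uIcc 1 w, ‖-Δ * z ^ (-Δ - 1) - (-Δ)‖ ≤ K * |w - 1| := fun z hz => by
    have hz1 : |z - 1| ≤ |w - 1| := Set.abs_sub_left_of_mem_uIcc hz
    have hL := hK.dist_le_mul z (hI z hz).2 1 h1t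
    rw [Real.one_rpow, mul_one, Real.dist_eq, Real.dist_eq] at hL
    rw [Real.norm_eq_abs]
    exact hL.trans (by gcongr)
  have hMVT := Convex.norm_image_sub_le_of_norm_hasDerivWithin_le hderiv hbound
    (convex_uIcc 1 w) Set.left_mem_uIcc Set.right_mem_uIcc
  have hg1 : (1 : ℝ) ^ (-Δ) - 1 + Δ * (1 - 1) = 0 := by simp
  rw [hg1, sub_zero, Real.norm_eq_abs, Real.norm_eq_abs] at hMVT
  calc |w ^ (-Δ) - 1 + Δ * (w - 1)| ≤ K * |w - 1| * |w - 1| := hMVT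
    _ = K * (w - 1) ^ 2 := by rw [mul_assoc, ← pow_two, sq_abs]

/-- Pointwise far-field estimate for the pure power: with `r = ‖y‖ ≥ R ≥ ‖v‖`, `r > 0` and
`3R < δ r`, `|r^{2Δ+1} ‖v - y‖^{-2Δ} - r - 2Δ ⟪v, y/r⟫| ≤ (9C + |Δ|) R² / r`, where `(C, δ)` is a
second-order Taylor bound for `w ↦ w^{-Δ}` at `1`. [folklore] -/
theorem abs_farField_rpow_sub_le {V : Type*} [NormedAddCommGroup V] [InnerProductSpace ℝ V]
    {Δ C δ R : ℝ} (hC : 0 ≤ C)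
    (hT : ∀ w : ℝ, |w - 1| < δ → |w ^ (-Δ) - 1 + Δ * (w - 1)| ≤ C * (w - 1) ^ 2)
    {y v : V} (hv : ‖v‖ ≤ R) (hRy : R ≤ ‖y‖) (hy : 0 < ‖y‖) (hδy : 3 * R < δ * ‖y‖) :
    |‖y‖ ^ (2 * Δ + 1) * ‖v - y‖ ^ (-(2 * Δ)) - ‖y‖ - 2 * Δ * inner ℝ v (‖y‖⁻¹ • y)|
      ≤ (9 * C + |Δ|) * R ^ 2 * ‖y‖⁻¹ := by
  set r := ‖y‖ with hr
  have hr0 : r ≠ 0 := hy.ne'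
  have hR : 0 ≤ R := (norm_nonneg v).trans hv
  have hr2 : (0 : ℝ) < r ^ 2 := by positivity
  set t := (‖v‖ ^ 2 - 2 * inner ℝ v y) / r ^ 2 with ht_def
  have hvy : ‖v - y‖ ^ 2 = r ^ 2 * (1 + t) := by
    rw [norm_sub_sq_real, ← hr, ht_def]
    field_simp
    ring
  have ht_abs : |t| ≤ 3 * R / r := by
    have hnum : |‖v‖ ^ 2 - 2 * inner ℝ v y| ≤ 3 * R * r := by
      have h1 : |inner ℝ v y| ≤ R * r := (abs_real_inner_le_norm v y).trans (by gcongr)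
      have h2 : ‖v‖ ^ 2 ≤ R * r := by nlinarith [norm_nonneg v]
      calc |‖v‖ ^ 2 - 2 * inner ℝ v y| ≤ |‖v‖ ^ 2| + |2 * inner ℝ v y| := abs_sub _ _
        _ = ‖v‖ ^ 2 + 2 * |inner ℝ v y| := by
          rw [abs_of_nonneg (sq_nonneg _), abs_mul, abs_two]
        _ ≤ R * r + 2 * (R * r) := by gcongr
        _ = 3 * R * r := by ring
    calc |t| = |‖v‖ ^ 2 - 2 * inner ℝ v y| / r ^ 2 := by
          rw [ht_def, abs_div, abs_of_pos hr2]
      _ ≤ 3 * R * r / r ^ 2 := by gcongr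
      _ = 3 * R / r := by field_simp
  have htδ : |t| < δ := by
    refine ht_abs.trans_lt ?_
    rw [div_lt_iff₀ hy]
    linarith
  have hw0 : 0 ≤ 1 + t := by
    have h0 : 0 ≤ ‖v - y‖ ^ 2 := sq_nonneg _
    rw [hvy] at h0
    exact (mul_nonneg_iff_of_pos_left hr2).mp h0
  have hpow : ‖v - y‖ ^ (-(2 * Δ)) = (r ^ 2) ^ (-Δ) * (1 + t) ^ (-Δ) := by
    rw [← Real.mul_rpow hr2.le hw0, ← hvy,
      show (-(2 * Δ)) = (2 : ℝ) * (-Δ) by ring, Real.rpow_mul (norm_nonneg _), Real.rpow_two]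
  have hr_pow : r ^ (2 * Δ + 1) * (r ^ 2) ^ (-Δ) = r := by
    rw [← Real.rpow_two, ← Real.rpow_mul hy.le, ← Real.rpow_add hy]
    rw [show 2 * Δ + 1 + 2 * -Δ = (1 : ℝ) by ring, Real.rpow_one]
  rw [hpow, ← mul_assoc, hr_pow, real_inner_smul_right]
  have hid : r * (1 + t) ^ (-Δ) - r - 2 * Δ * (r⁻¹ * inner ℝ v y)
      = r * ((1 + t) ^ (-Δ) - 1 + Δ * t) - Δ * ‖v‖ ^ 2 * r⁻¹ := by
    rw [ht_def]
    field_simp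
    ring
  rw [hid]
  have hTt := hT (1 + t) (by simpa using htδ)
  simp only [add_sub_cancel_left] at hTt
  have ht2 : t ^ 2 ≤ (3 * R / r) ^ 2 := by
    rw [← sq_abs t]
    exact pow_le_pow_left₀ (abs_nonneg t) ht_abs 2
  calc |r * ((1 + t) ^ (-Δ) - 1 + Δ * t) - Δ * ‖v‖ ^ 2 * r⁻¹|
      ≤ |r * ((1 + t) ^ (-Δ) - 1 + Δ * t)| + |Δ * ‖v‖ ^ 2 * r⁻¹| := abs_sub _ _
    _ = r * |(1 + t) ^ (-Δ) - 1 + Δ * t| + |Δ| * ‖v‖ ^ 2 * r⁻¹ := by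
      rw [abs_mul, abs_of_pos hy, abs_mul, abs_mul, abs_of_nonneg (sq_nonneg ‖v‖),
        abs_of_pos (inv_pos.2 hy)]
    _ ≤ r * (C * t ^ 2) + |Δ| * R ^ 2 * r⁻¹ := by gcongr
    _ ≤ r * (C * (3 * R / r) ^ 2) + |Δ| * R ^ 2 * r⁻¹ := by
      have := mul_le_mul_of_nonneg_left (mul_le_mul_of_nonneg_left ht2 hC) hy.le
      linarith
    _ = (9 * C + |Δ|) * R ^ 2 * r⁻¹ := by
      field_simp
      ring

/-- **Uniform far-field expansion of the pure power.** For every `Δ R : ℝ`,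
`‖y‖^{2Δ+1} ‖v - y‖^{-2Δ} - ‖y‖ - 2Δ ⟪v, ‖y‖⁻¹ • y⟫ → 0` as `y → ∞`, uniformly in `‖v‖ ≤ R`
(product filter `cocompact ×ˢ 𝓟 (closedBall 0 R)`): the pure power `‖v - y‖^{-2Δ}` has monopole
`1` and dipole `2Δ v` at infinity (the two-point function of a quasi-primary field,
Di Francesco–Mathieu–Sénéchal 1997, §4.3.1, eq. (4.55)).
[cite: FrancescoMathieuSenechal1997, §4.3.1 eq. (4.55)] -/
theorem tendsto_farField_rpow {V : Type*} [NormedAddCommGroup V] [InnerProductSpace ℝ V]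
    [ProperSpace V] (Δ R : ℝ) :
    Tendsto (fun q : V × V => ‖q.1‖ ^ (2 * Δ + 1) * ‖q.2 - q.1‖ ^ (-(2 * Δ)) - ‖q.1‖
        - 2 * Δ * inner ℝ q.2 (‖q.1‖⁻¹ • q.1))
      (cocompact V ×ˢ 𝓟 (Metric.closedBall (0 : V) R)) (𝓝 0) := by
  obtain ⟨C, δ, hC, hδ, hT⟩ := exists_rpow_neg_sub_taylor_bound Δ
  have hnorm : Tendsto (fun q : V × V => ‖q.1‖) (cocompact V ×ˢ 𝓟 (Metric.closedBall (0 : V) R))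
      atTop := tendsto_norm_cocompact_atTop.comp tendsto_fst
  have hmaj : Tendsto (fun q : V × V => (9 * C + |Δ|) * R ^ 2 * ‖q.1‖⁻¹)
      (cocompact V ×ˢ 𝓟 (Metric.closedBall (0 : V) R)) (𝓝 0) := by
    have := (tendsto_inv_atTop_zero.comp hnorm).const_mul ((9 * C + |Δ|) * R ^ 2)
    rw [mul_zero] at this
    exact this
  refine squeeze_zero_norm' ?_ hmaj
  have h1 : ∀ᶠ q : V × V in cocompact V ×ˢ 𝓟 (Metric.closedBall (0 : V) R),
      max R (3 * R / δ) < ‖q.1‖ := hnorm.eventually_gt_atTop _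
  have h2 : ∀ᶠ q : V × V in cocompact V ×ˢ 𝓟 (Metric.closedBall (0 : V) R), ‖q.2‖ ≤ R :=
    (eventually_principal.2 fun v hv => mem_closedBall_zero_iff.mp hv).prod_inr _
  filter_upwards [h1, h2] with q hq1 hq2
  have hR : R < ‖q.1‖ := (le_max_left _ _).trans_lt hq1
  have hy : 0 < ‖q.1‖ := ((norm_nonneg q.2).trans hq2).trans_lt hR
  have hδy : 3 * R < δ * ‖q.1‖ := by
    have h3 : 3 * R / δ < ‖q.1‖ := (le_max_right _ _).trans_lt hq1
    rwa [div_lt_iff₀' hδ] at h3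
  rw [Real.norm_eq_abs]
  exact abs_farField_rpow_sub_le hC hT hq2 hR.le hy hδy

/-- **Far-field expansion of a pure power.** If the `(n+1)`-point function is
`S_{n+1}(x, y) = c ‖x₀(x) - y‖^{-2Δ}` for a source point `x₀(x)` depending continuously on the
non-coincident configuration `x` (and `y ≠ x₀(x)`), then it has the far-field expansion with
monopole `A₀ = c` and dipole `A₁ = 2Δ c x₀`:
`c ‖x₀ - y‖^{-2Δ} = ‖y‖^{-2Δ} [c + 2Δ c ŷ·x₀/‖y‖ + o(1/‖y‖)]`. (Expansion at infinity of the
quasi-primary two-point function, Di Francesco–Mathieu–Sénéchal 1997, §4.3.1, eq. (4.55).)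
[cite: FrancescoMathieuSenechal1997, §4.3.1 eq. (4.55)] -/
theorem hasFarFieldExpansion_of_eq_rpow {c : ℝ}
    {x₀ : (Fin n → EuclideanSpace ℝ (Fin d)) → EuclideanSpace ℝ (Fin d)}
    (hx₀ : ContinuousOn x₀ (NonCoincident d n))
    (hS : ∀ x ∈ NonCoincident d n, ∀ y : EuclideanSpace ℝ (Fin d), y ≠ x₀ x →
      S (n + 1) (Fin.snoc x y) = c * ‖x₀ x - y‖ ^ (-(2 * Δ))) :
    HasFarFieldExpansion S Δ n (fun _ => c) (fun x => (2 * Δ * c) • x₀ x) := by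
  rw [hasFarFieldExpansion_iff_tendsto]
  intro x hx
  set R : ℝ := ‖x₀ x‖ + 1 with hR_def
  have hc : ContinuousAt x₀ x := hx₀.continuousAt ((isOpen_nonCoincident d n).mem_nhds hx)
  have hballR : ∀ᶠ x' in 𝓝 x, x₀ x' ∈ Metric.closedBall (0 : EuclideanSpace ℝ (Fin d)) R := by
    have hev : ∀ᶠ x' in 𝓝 x, x₀ x' ∈ Metric.closedBall (x₀ x) 1 :=
      hc (Metric.closedBall_mem_nhds _ one_pos)
    filter_upwards [hev] with x' hx'
    rw [mem_closedBall_zero_iff]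
    rw [mem_closedBall_iff_norm] at hx'
    have := norm_le_insert' (x₀ x') (x₀ x)
    linarith
  have hx₀t : Tendsto x₀ (𝓝 x) (𝓟 (Metric.closedBall (0 : EuclideanSpace ℝ (Fin d)) R)) :=
    tendsto_principal.2 hballR
  have H := ((tendsto_farField_rpow (V := EuclideanSpace ℝ (Fin d)) Δ R).comp
    (tendsto_fst.prodMk (hx₀t.comp tendsto_snd))).const_mul c
  rw [mul_zero] at H
  refine H.congr' ?_
  have hev1 : ∀ᶠ q : EuclideanSpace ℝ (Fin d) × (Fin n → EuclideanSpace ℝ (Fin d)) in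
      cocompact (EuclideanSpace ℝ (Fin d)) ×ˢ 𝓝 x,
      q.2 ∈ NonCoincident d n ∧ x₀ q.2 ∈ Metric.closedBall (0 : EuclideanSpace ℝ (Fin d)) R :=
    (((isOpen_nonCoincident d n).eventually_mem hx).and hballR).prod_inr _
  have hev2 : ∀ᶠ q : EuclideanSpace ℝ (Fin d) × (Fin n → EuclideanSpace ℝ (Fin d)) in
      cocompact (EuclideanSpace ℝ (Fin d)) ×ˢ 𝓝 x, R < ‖q.1‖ :=
    (tendsto_norm_cocompact_atTop.eventually_gt_atTop R).prod_inl _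
  filter_upwards [hev1, hev2] with q hq1 hq2
  have hne : q.1 ≠ x₀ q.2 := by
    intro hq
    rw [hq] at hq2
    have hle : ‖x₀ q.2‖ ≤ R := mem_closedBall_zero_iff.mp hq1.2
    linarith
  simp only [Function.comp_apply]
  rw [hS q.2 hq1.1 q.1 hne, real_inner_smul_left]
  ring

/-- Far-field expansion of `S_{n+1}(x, y) = c ‖x i - y‖^{-2Δ}` (a power centred at one of the
points of the configuration): monopole `c`, dipole `2Δ c x i`.
(Di Francesco–Mathieu–Sénéchal 1997, §4.3.1, eq. (4.55).)
[cite: FrancescoMathieuSenechal1997, §4.3.1 eq. (4.55)] -/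
theorem hasFarFieldExpansion_of_eq_rpow_coord {c : ℝ} (i : Fin n)
    (hS : ∀ x ∈ NonCoincident d n, ∀ y : EuclideanSpace ℝ (Fin d), y ≠ x i →
      S (n + 1) (Fin.snoc x y) = c * ‖x i - y‖ ^ (-(2 * Δ))) :
    HasFarFieldExpansion S Δ n (fun _ => c) (fun x => (2 * Δ * c) • x i) :=
  hasFarFieldExpansion_of_eq_rpow (continuous_apply i).continuousOn hS

/-- **The two-point function.** If `S 2 ![a, b] = c ‖a - b‖^{-2Δ}` for `a ≠ b` (the quasi-primary
two-point function, Di Francesco–Mathieu–Sénéchal 1997, §4.3.1, eq. (4.55)), then `S` has the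
far-field expansion at level `n = 1` with monopole `c` and dipole `2Δ c x₀`:
`S₂(x₀, y) = ‖y‖^{-2Δ} [c + 2Δ c ŷ·x₀/‖y‖ + o(1/‖y‖)]`.
[cite: FrancescoMathieuSenechal1997, §4.3.1 eq. (4.55)] -/
theorem hasFarFieldExpansion_twoPoint {c : ℝ}
    (hS : ∀ a b : EuclideanSpace ℝ (Fin d), a ≠ b → S 2 ![a, b] = c * ‖a - b‖ ^ (-(2 * Δ))) :
    HasFarFieldExpansion S Δ 1 (fun _ => c) (fun x => (2 * Δ * c) • x 0) := by
  refine hasFarFieldExpansion_of_eq_rpow_coord 0 fun x _ y hy => ?_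
  have hxy : (Fin.snoc x y : Fin 2 → EuclideanSpace ℝ (Fin d)) = ![x 0, y] := by
    funext j
    fin_cases j <;> rfl
  rw [hxy]
  exact hS _ _ (Ne.symm hy)

/-! ### Additivity and scaling -/

/-- Far-field expansions add: coefficients of `S + S'` are the sums of the coefficients.
[folklore] -/
theorem HasFarFieldExpansion.add (h : HasFarFieldExpansion S Δ n A₀ A₁)
    (h' : HasFarFieldExpansion S' Δ n B₀ B₁) :
    HasFarFieldExpansion (S + S') Δ n (A₀ + B₀) (A₁ + B₁) := by
  rw [hasFarFieldExpansion_iff_tendsto] at h h' ⊢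
  intro x hx
  have H := (h x hx).add (h' x hx)
  rw [add_zero] at H
  refine H.congr' (Eventually.of_forall fun q => ?_)
  simp only [Pi.add_apply, inner_add_left]
  ring

/-- Far-field expansions scale: coefficients of `c • S` are `c A₀`, `c A₁`. [folklore] -/
theorem HasFarFieldExpansion.smul (h : HasFarFieldExpansion S Δ n A₀ A₁) (c : ℝ) :
    HasFarFieldExpansion (c • S) Δ n (c • A₀) (c • A₁) := by
  rw [hasFarFieldExpansion_iff_tendsto] at h ⊢
  intro x hx
  have H := (h x hx).const_mul c
  rw [mul_zero] at H
  refine H.congr' (Eventually.of_forall fun q => ?_)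
  simp only [Pi.smul_apply, smul_eq_mul, real_inner_smul_left]
  ring

end Literature.Probability.LatticeModels
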